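import Summits.CriticalPhenomena.SAWScalingLimit.Theorems.BoundaryTP2Negative_Box3
import HarnessLib

/-!
# Negative knowledge on crux `BoundaryTP2`, part 7: circular TP₃ already fails on the 3 × 3 box

The idea card behind the route conjectured non-negativity of ALL circular minors of the critical SAW boundary
kernel ("the polymer is totally positive"); the route keeps only order 2 (`BoundaryTP2`) after refuters found
negative minors of order rows + 1 on strips.  Here is the smallest certified instance: on the 3 × 3 box `Ω₃`,
for the cyclically ordered boundary sites `a₁=(1,0) < a₂=(2,0) < a₃=(2,1) < b₃=(2,2) < b₂=(1,2) < b₁=(0,0)`,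
`det [Z(aᵢ,bⱼ)] < 0` for EVERY fugacity `x ∈ [0.3703, 0.3847] ⊇ [1/2.7, 1/2.6]`, hence at `x_c` under the quoted
bounds on `μ` (`circularTP3_fails_at_xc`).  The nine entries are exact (part 3, `Z₃_eq`); negativity of the
degree-24 polynomial on the interval is certified by a kernel-checked monotone subdivision (144 rational
grid points `t_k = (3703+k)/10⁴`, denominators cleared, kernel `decide` on `ℕ`): writing `det = P - N` with
`P`, `N` sums of products of polynomials with natural coefficients, `P(t_{k+1}) < N(t_k)` on each grid cell.  Everything proved. [folklore]
-/

namespace Summit.CriticalPhenomena.SAWScalingLimit.Theorems.BoundaryTP2.Negative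

open Literature.Probability.LatticeModels Literature.Probability.RandomPlanarGeometry
open scoped ENNReal

/-! ### Exponent lists evaluated over `ℝ` -/

/-- `Σ_{k ∈ l} x^k` over `ℝ`. [folklore] -/
noncomputable def evR (l : List ℕ) (x : ℝ) : ℝ := (l.map fun k => x ^ k).sum

/-- The evaluation is non-negative for `x ≥ 0`. [folklore] -/
theorem evR_nonneg (l : List ℕ) {x : ℝ} (hx : 0 ≤ x) : 0 ≤ evR l x := by
  induction l with
  | nil => simp [evR]
  | cons k l ih =>
    simp only [evR, List.map_cons, List.sum_cons] at ih ⊢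
    exact add_nonneg (pow_nonneg hx k) ih

/-- The evaluation is monotone in `x ≥ 0`. [folklore] -/
theorem evR_mono (l : List ℕ) {x y : ℝ} (hx : 0 ≤ x) (hxy : x ≤ y) : evR l x ≤ evR l y := by
  induction l with
  | nil => simp [evR]
  | cons k l ih =>
    simp only [evR, List.map_cons, List.sum_cons] at ih ⊢
    exact add_le_add (pow_le_pow_left₀ hx hxy k) ih

/-! ### The nine entries (step counts of the complete enumerations, part 3) -/

/-- `Z((1,0),(0,0))`. [folklore] -/ def l₁₁ : List ℕ := [5, 7, 7, 7, 1, 7, 3, 5]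
/-- `Z((1,0),(1,2))`. [folklore] -/ def l₁₂ : List ℕ := [6, 4, 4, 6, 4, 4, 4, 4, 2]
/-- `Z((1,0),(2,2))`. [folklore] -/ def l₁₃ : List ℕ := [7, 5, 3, 5, 5, 5, 7, 3, 5, 3]
/-- `Z((2,0),(0,0))`. [folklore] -/ def l₂₁ : List ℕ := [2, 8, 4, 6, 4, 6, 4, 8, 6, 6, 6]
/-- `Z((2,0),(1,2))`. [folklore] -/ def l₂₂ : List ℕ := [7, 5, 5, 5, 5, 3, 5, 3, 7, 3]
/-- `Z((2,0),(2,2))`. [folklore] -/ def l₂₃ : List ℕ := [6, 6, 6, 8, 4, 6, 4, 6, 4, 8, 2]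
/-- `Z((2,1),(0,0))`. [folklore] -/ def l₃₁ : List ℕ := [3, 5, 3, 7, 5, 5, 5, 3, 5, 7]
/-- `Z((2,1),(1,2))`. [folklore] -/ def l₃₂ : List ℕ := [4, 2, 6, 2, 6, 6, 6, 4]
/-- `Z((2,1),(2,2))`. [folklore] -/ def l₃₃ : List ℕ := [5, 3, 7, 1, 7, 7, 7, 5]

/-- The exact entries as real sums (part 3's `Z₃_eq`, kernel `decide`). [folklore] -/
theorem Z₃_entries {x : ℝ} (hx : 0 ≤ x) :
    Z₃ x ![1, 0] ![0, 0] = ENNReal.ofReal (evR l₁₁ x) ∧ Z₃ x ![1, 0] ![1, 2] = ENNReal.ofReal (evR l₁₂ x) ∧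
    Z₃ x ![1, 0] ![2, 2] = ENNReal.ofReal (evR l₁₃ x) ∧ Z₃ x ![2, 0] ![0, 0] = ENNReal.ofReal (evR l₂₁ x) ∧
    Z₃ x ![2, 0] ![1, 2] = ENNReal.ofReal (evR l₂₂ x) ∧ Z₃ x ![2, 0] ![2, 2] = ENNReal.ofReal (evR l₂₃ x) ∧
    Z₃ x ![2, 1] ![0, 0] = ENNReal.ofReal (evR l₃₁ x) ∧ Z₃ x ![2, 1] ![1, 2] = ENNReal.ofReal (evR l₃₂ x) ∧
    Z₃ x ![2, 1] ![2, 2] = ENNReal.ofReal (evR l₃₃ x) :=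
  ⟨Z₃_eq (by decide) _ (by decide) (by decide) hx, Z₃_eq (by decide) _ (by decide) (by decide) hx,
   Z₃_eq (by decide) _ (by decide) (by decide) hx, Z₃_eq (by decide) _ (by decide) (by decide) hx,
   Z₃_eq (by decide) _ (by decide) (by decide) hx, Z₃_eq (by decide) _ (by decide) (by decide) hx,
   Z₃_eq (by decide) _ (by decide) (by decide) hx, Z₃_eq (by decide) _ (by decide) (by decide) hx,
   Z₃_eq (by decide) _ (by decide) (by decide) hx⟩

/-! ### The determinant as a difference of two monotone polynomials -/

/-- Positive part over `ℝ`. [folklore] -/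
noncomputable def PR (x : ℝ) : ℝ :=
  evR l₁₁ x * evR l₂₂ x * evR l₃₃ x + evR l₁₂ x * evR l₂₃ x * evR l₃₁ x + evR l₁₃ x * evR l₂₁ x * evR l₃₂ x

/-- Negative part over `ℝ`. [folklore] -/
noncomputable def NR (x : ℝ) : ℝ :=
  evR l₁₁ x * evR l₂₃ x * evR l₃₂ x + evR l₁₂ x * evR l₂₁ x * evR l₃₃ x + evR l₁₃ x * evR l₂₂ x * evR l₃₁ x

/-- A product of three evaluations is monotone on `x ≥ 0`. [folklore] -/
theorem evR_mul3_mono (l m n : List ℕ) {x y : ℝ} (hx : 0 ≤ x) (hxy : x ≤ y) :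
    evR l x * evR m x * evR n x ≤ evR l y * evR m y * evR n y := by
  have h1 := evR_mono l hx hxy; have h2 := evR_mono m hx hxy; have h3 := evR_mono n hx hxy
  have p1 := evR_nonneg l hx; have p2 := evR_nonneg m hx; have p3 := evR_nonneg n hx
  have q1 := evR_nonneg l (hx.trans hxy); have q2 := evR_nonneg m (hx.trans hxy)
  exact mul_le_mul (mul_le_mul h1 h2 p2 q1) h3 p3 (mul_nonneg q1 q2)

/-- `PR` is monotone on `x ≥ 0`. [folklore] -/
theorem PR_mono {x y : ℝ} (hx : 0 ≤ x) (hxy : x ≤ y) : PR x ≤ PR y :=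
  add_le_add (add_le_add (evR_mul3_mono _ _ _ hx hxy) (evR_mul3_mono _ _ _ hx hxy)) (evR_mul3_mono _ _ _ hx hxy)

/-- `NR` is monotone on `x ≥ 0`. [folklore] -/
theorem NR_mono {x y : ℝ} (hx : 0 ≤ x) (hxy : x ≤ y) : NR x ≤ NR y :=
  add_le_add (add_le_add (evR_mul3_mono _ _ _ hx hxy) (evR_mul3_mono _ _ _ hx hxy)) (evR_mul3_mono _ _ _ hx hxy)

/-! ### The subdivision certificate (cleared denominators: pure `ℕ` arithmetic, kernel `decide`) -/

/-- Homogenised evaluation `Σ a^k D^{8-k} = D⁸ · Σ (a/D)^k` (all exponents are `≤ 8`). [folklore] -/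
def evN (l : List ℕ) (a D : ℕ) : ℕ := (l.map fun k => a ^ k * D ^ (8 - k)).sum

/-- The homogenisation identity. [folklore] -/
theorem evR_div_mul_pow (l : List ℕ) (hl : ∀ k ∈ l, k ≤ 8) (a D : ℕ) (hD : (D : ℝ) ≠ 0) :
    evR l ((a : ℝ) / D) * (D : ℝ) ^ 8 = (evN l a D : ℝ) := by
  induction l with
  | nil => simp [evR, evN]
  | cons k l ih =>
    have hk : k ≤ 8 := hl k (by simp)
    have ih' := ih (fun m hm => hl m (by simp [hm]))
    simp only [evR, evN, List.map_cons, List.sum_cons, Nat.cast_add, Nat.cast_mul, Nat.cast_pow] at ih' ⊢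
    rw [add_mul, ih']
    congr 1
    rw [div_pow]
    have : (D : ℝ) ^ 8 = (D : ℝ) ^ k * (D : ℝ) ^ (8 - k) := by rw [← pow_add]; congr 1; omega
    rw [this]
    field_simp

/-- The common denominator `D = 10⁴`. [folklore] -/
def Dn : ℕ := 10000

/-- `D²⁴ · P(a/D)` as a natural number. [folklore] -/
def PN (a : ℕ) : ℕ :=
  evN l₁₁ a Dn * evN l₂₂ a Dn * evN l₃₃ a Dn + evN l₁₂ a Dn * evN l₂₃ a Dn * evN l₃₁ a Dn +
    evN l₁₃ a Dn * evN l₂₁ a Dn * evN l₃₂ a Dn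

/-- `D²⁴ · N(a/D)` as a natural number. [folklore] -/
def NN (a : ℕ) : ℕ :=
  evN l₁₁ a Dn * evN l₂₃ a Dn * evN l₃₂ a Dn + evN l₁₂ a Dn * evN l₂₁ a Dn * evN l₃₃ a Dn +
    evN l₁₃ a Dn * evN l₂₂ a Dn * evN l₃₁ a Dn

/-- All exponents are at most `8`. [folklore] -/
theorem exps_le_eight :
    (∀ k ∈ l₁₁, k ≤ 8) ∧ (∀ k ∈ l₁₂, k ≤ 8) ∧ (∀ k ∈ l₁₃, k ≤ 8) ∧ (∀ k ∈ l₂₁, k ≤ 8) ∧ (∀ k ∈ l₂₂, k ≤ 8) ∧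
    (∀ k ∈ l₂₃, k ≤ 8) ∧ (∀ k ∈ l₃₁, k ≤ 8) ∧ (∀ k ∈ l₃₂, k ≤ 8) ∧ (∀ k ∈ l₃₃, k ≤ 8) := by
  refine ⟨?_, ?_, ?_, ?_, ?_, ?_, ?_, ?_, ?_⟩ <;> decide

/-- `PR(a/D) · D²⁴ = PN a`. [folklore] -/
theorem PR_hom (a : ℕ) : PR ((a : ℝ) / Dn) * (Dn : ℝ) ^ 24 = (PN a : ℝ) := by
  have hD : ((Dn : ℕ) : ℝ) ≠ 0 := by norm_num [Dn]
  obtain ⟨h11, h12, h13, h21, h22, h23, h31, h32, h33⟩ := exps_le_eight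
  have e := fun l hl => evR_div_mul_pow l hl a Dn hD
  simp only [PR, PN, Nat.cast_add, Nat.cast_mul, ← e l₁₁ h11, ← e l₁₂ h12, ← e l₁₃ h13, ← e l₂₁ h21,
    ← e l₂₂ h22, ← e l₂₃ h23, ← e l₃₁ h31, ← e l₃₂ h32, ← e l₃₃ h33]
  ring

/-- `NR(a/D) · D²⁴ = NN a`. [folklore] -/
theorem NR_hom (a : ℕ) : NR ((a : ℝ) / Dn) * (Dn : ℝ) ^ 24 = (NN a : ℝ) := by
  have hD : ((Dn : ℕ) : ℝ) ≠ 0 := by norm_num [Dn]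
  obtain ⟨h11, h12, h13, h21, h22, h23, h31, h32, h33⟩ := exps_le_eight
  have e := fun l hl => evR_div_mul_pow l hl a Dn hD
  simp only [NR, NN, Nat.cast_add, Nat.cast_mul, ← e l₁₁ h11, ← e l₁₂ h12, ← e l₁₃ h13, ← e l₂₁ h21,
    ← e l₂₂ h22, ← e l₂₃ h23, ← e l₃₁ h31, ← e l₃₂ h32, ← e l₃₃ h33]
  ring

/-- **The certificate**: `P(t_{k+1}) < N(t_k)` on all 144 cells `t_k = (3703+k)/10⁴`, as `ℕ` inequalities
(kernel `decide`, GMP arithmetic). [folklore] -/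
theorem cert : ((List.range 144).all fun k => Nat.blt (PN (3703 + k + 1)) (NN (3703 + k))) = true := by
  decide

/-- One cell of the certificate. [folklore] -/
theorem cert_cell {k : ℕ} (hk : k < 144) : PN (3703 + k + 1) < NN (3703 + k) := by
  have h := List.all_eq_true.1 cert k (List.mem_range.2 hk)
  rwa [Nat.blt_eq] at h

/-- **`P < N` on the whole interval `[0.3703, 0.3847]`.** [folklore] -/
theorem PR_lt_NR {x : ℝ} (h0 : (3703 : ℝ) / 10000 ≤ x) (h1 : x ≤ (3847 : ℝ) / 10000) : PR x < NR x := by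
  -- locate the cell
  set s : ℝ := (x - 3703 / 10000) * 10000 with hs
  have hs0 : 0 ≤ s := by rw [hs]; nlinarith
  have hs1 : s ≤ 144 := by rw [hs]; nlinarith
  set k : ℕ := min 143 ⌊s⌋₊ with hkdef
  have hk : k < 144 := by omega
  have hks : (k : ℝ) ≤ s := by
    have : (k : ℝ) ≤ ⌊s⌋₊ := by exact_mod_cast min_le_right 143 ⌊s⌋₊
    exact this.trans (Nat.floor_le hs0)
  have hsk : s ≤ k + 1 := by
    rcases le_or_gt 143 ⌊s⌋₊ with hfl | hfl
    · have : k = 143 := by omega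
      rw [this]; norm_num; linarith
    · have : k = ⌊s⌋₊ := by omega
      rw [this]; exact (Nat.lt_floor_add_one s).le
  have hx0 : 0 ≤ x := by linarith
  have hlo : (((3703 + k : ℕ) : ℝ) / Dn) ≤ x := by
    rw [show ((Dn : ℕ) : ℝ) = 10000 by norm_num [Dn], div_le_iff₀ (by norm_num : (0 : ℝ) < 10000)]
    push_cast
    rw [hs] at hks; linarith
  have hhi : x ≤ (((3703 + k + 1 : ℕ) : ℝ) / Dn) := by
    rw [show ((Dn : ℕ) : ℝ) = 10000 by norm_num [Dn], le_div_iff₀ (by norm_num : (0 : ℝ) < 10000)]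
    push_cast
    rw [hs] at hsk; linarith
  have htk0 : (0 : ℝ) ≤ ((3703 + k : ℕ) : ℝ) / Dn := by positivity
  have hD : (0 : ℝ) < (Dn : ℝ) ^ 24 := by norm_num [Dn]
  have key : PR (((3703 + k + 1 : ℕ) : ℝ) / Dn) < NR (((3703 + k : ℕ) : ℝ) / Dn) := by
    rw [← mul_lt_mul_iff_of_pos_right hD, PR_hom, NR_hom]
    exact_mod_cast cert_cell hk
  calc PR x ≤ PR (((3703 + k + 1 : ℕ) : ℝ) / Dn) := PR_mono hx0 hhi
    _ < NR (((3703 + k : ℕ) : ℝ) / Dn) := key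
    _ ≤ NR x := NR_mono htk0 hlo

/-- **The circular 3 × 3 minor is negative for every fugacity in `[0.3703, 0.3847]`** (real form, with the
exact two-point sums of `Ω₃`). [folklore] -/
theorem det3_neg {x : ℝ} (h0 : (3703 : ℝ) / 10000 ≤ x) (h1 : x ≤ (3847 : ℝ) / 10000) :
    evR l₁₁ x * (evR l₂₂ x * evR l₃₃ x - evR l₂₃ x * evR l₃₂ x)
      - evR l₁₂ x * (evR l₂₁ x * evR l₃₃ x - evR l₂₃ x * evR l₃₁ x)
      + evR l₁₃ x * (evR l₂₁ x * evR l₃₂ x - evR l₂₂ x * evR l₃₁ x) < 0 := by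
  have h := PR_lt_NR h0 h1
  simp only [PR, NR] at h
  linarith

/-- **Circular TP₃ fails at the critical fugacity on the 3 × 3 box** (under the quoted bounds
`2.6 ≤ μ ≤ 2.7`, which the tree discharges computationally): with `Z = Z₃ x_c` (= `SAW.weight Ω₃ 1 · · univ`,
part 3) and the cyclically ordered boundary sextuple `a = ((1,0),(2,0),(2,1))`, `b = ((0,0),(1,2),(2,2))`,
the minor `det [Z(aᵢ,bⱼ)]` (computed in `ℝ` through `ENNReal.toReal`) is negative. [folklore] -/
theorem circularTP3_fails_at_xc (hμ : SAW.LawlerSchrammWerner2004SAW_connectiveConstant_bounds) :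
    let Z : Site 2 → Site 2 → ℝ := fun u v => (Z₃ SAW.criticalFugacity u v).toReal
    Z ![1, 0] ![0, 0] * (Z ![2, 0] ![1, 2] * Z ![2, 1] ![2, 2] - Z ![2, 0] ![2, 2] * Z ![2, 1] ![1, 2])
      - Z ![1, 0] ![1, 2] * (Z ![2, 0] ![0, 0] * Z ![2, 1] ![2, 2] - Z ![2, 0] ![2, 2] * Z ![2, 1] ![0, 0])
      + Z ![1, 0] ![2, 2] * (Z ![2, 0] ![0, 0] * Z ![2, 1] ![1, 2] - Z ![2, 0] ![1, 2] * Z ![2, 1] ![0, 0]) < 0 := by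
  have hx := SAW.criticalFugacity_pos_lt_one hμ
  have hx1 : SAW.criticalFugacity ≤ 5 / 13 := by
    rw [SAW.criticalFugacity]
    have h26 := hμ.1
    rw [inv_le_comm₀ (by linarith) (by norm_num)]
    norm_num; linarith
  have hx0 : (10 : ℝ) / 27 ≤ SAW.criticalFugacity := by
    rw [SAW.criticalFugacity]
    have h26 := hμ.1
    have h27 := hμ.2
    rw [le_inv_comm₀ (by norm_num) (by linarith)]
    norm_num; linarith
  obtain ⟨e11, e12, e13, e21, e22, e23, e31, e32, e33⟩ := Z₃_entries hx.1.le
  intro Z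
  have hZ : ∀ {u v : Site 2} {l : List ℕ}, Z₃ SAW.criticalFugacity u v = ENNReal.ofReal (evR l SAW.criticalFugacity) →
      Z u v = evR l SAW.criticalFugacity := by
    intro u v l h
    show (Z₃ SAW.criticalFugacity u v).toReal = _
    rw [h, ENNReal.toReal_ofReal (evR_nonneg l hx.1.le)]
  rw [hZ e11, hZ e12, hZ e13, hZ e21, hZ e22, hZ e23, hZ e31, hZ e32, hZ e33]
  exact det3_neg (by linarith) (by linarith)

end Summit.CriticalPhenomena.SAWScalingLimit.Theorems.BoundaryTP2.Negative
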